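import Summits.BirchSwinnertonDyer.Rank1Residual.X11b.BDPRouteLocalIndexTransport
import Summits.BirchSwinnertonDyer.Rank1Residual.X11b.BDPRouteSelmerLevelBound
import Summits.BirchSwinnertonDyer.Rank1Residual.X11b.BDPRouteRankOneBookkeeping
import Summits.BirchSwinnertonDyer.Rank1Residual.X11b.BDPRouteRecordSelmerAlpha
import HarnessLib

/-!
# Class X11b, route "BDP + converse-theorem engine + Kolyvagin" (p2): the typed input (d)
# `P2SelmerCardBoundAt` is a THEOREM under (iv) — Cas18 (3.2.1)+(calcul) `≤` / JSW17 Prop. 3.2.1 `≤`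
# from Kolyvagin, Poitou–Tate and the local Euler characteristic (cell `b2b-bsdres`, `multr1-p2`, gen 16)

HONEST FRAMING (verbatim, cell `b2b-bsdres`): the goal of the cell is to DELETE the
COMBINATION-SHAPED residual classes for ALL analytic-rank `≤ 1` curves over `ℚ` — "full BSD
formula for every rank `≤ 1` curve in class `C`" assembled STRICTLY from published theorems — so
that the rank-`≤ 1` remainder becomes exactly the CONSTRUCTION-SHAPED classes, which are TYPED
(missing-input Props), NOT attempted; this is not "finishing BSD". Research route `p2` for class
X11b; no claim beyond the stated class; nothing booked; X11b stays CONSTRUCTION-SHAPED. Theorems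
only; no `sorry`; no new named fact (the published named facts Kolyvagin `kolyvagin`, Poitou–Tate
`poitouTate_sum_localTatePairing_eq_zero` = Milne ADT I Thm. 4.10(b), and Tate's local
Euler–Poincaré characteristic `localEulerPoincareCharacteristic` = Milne ADT I Thm. 2.8 enter as
hypotheses).

## Content

* **`p2SelmerCardBoundAt_of_facts`** — for a globally minimal elliptic `W/ℚ` and a prime `p` with
  (iv) `E(ℚ_p)[p] = 0`: `P2SelmerCardBoundAt W p` ((d): at every datum of route p2,
  `Sel_𝔭(K, E[p^∞])` is finite with
  `#Sel_𝔭(K, E[p^∞]) ≤ p^a`, `a ≤ ord_p #Ш(E/K)[p^∞] + 2((ord_p log_ω P − 1) − ord_p[E(K):ℤP]) + ord_p ∏_{w∣p} c_w`)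
  FOLLOWS from Kolyvagin (rank `E(K) = 1`, `Ш(E/K)` finite at a non-torsion Heegner point),
  Poitou–Tate over `K` and the local Euler characteristic at `K_𝔭̄`. Assembly of: the glue onto
  the sibling's propagated Castella structure (`BDPRouteLevelToKummer`), Part A
  (`BDPRouteStrictAtPlace`), Part B (`BDPRouteRelaxation`), the `𝔭 ↔ 𝔭̄` symmetry
  (`BDPRouteLocalIndexSymmetry`), the level bound (`BDPRouteSelmerLevelBound`), the local index
  (`BDPRouteLocalIndex`), the `K_𝔭 ≅ ℚ_p` transport / (G4) / (v) (`BDPRouteLocalIndexTransport`) and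
  the rank-one bookkeeping (`BDPRouteRankOneBookkeeping`). With `Q` a generator of `E(K)` modulo
  torsion and `e = ord_p log_ω Q + ord_p c_p − 1`: every level has `#H¹_{𝓛^{(k)}} ≤ p^e · #Ш[p^∞] · p^e`,
  and `e + ord_p[E(K):ℤP] ≤ ord_p log_ω P + ord_p c_p − 1`.
* **`P2.bsdp_of_onTree_selmer`** — THE STATEMENT OF RECORD with (d) DISCHARGED: the inputs of
  `P2.bsdp_of_onTree_weakest_alpha` (14 published named facts; (T1ᵗ-CTL≤) `P2ControlUpperOnTreeAt`
  ONLY on the (T2α) sub-shape — split multiplicative at `p` with `p ∣ ord_p Δ_min`; (T1ᵗ-IMC)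
  `P2OpenInputOnTreeAt` — THE open input at `p ∥ N`; (T2α′); (T2♯-ℝ) `P2ShimuraDisplaysAt`; (T3);
  (T4′)) PLUS the two textbook named facts (Poitou–Tate, local Euler characteristic), and NO (d).
  CONDITIONAL; nothing booked; reach, census numbers and labels UNCHANGED (the population is the
  same; one typed input fewer off (T2α)).

References: [Castella2018] Thm. 2.3, (3.2.1) and (calcul) (arXiv:1704.06608 pp. 5–6);
[Castella2018Erratum] Thm. 1.1 (iv); [JetchevSkinnerWan2017] Prop. 3.2.1, (7.1.5), §7.4.1;
[MilneADT2006] I Thm. 2.8, Thm. 4.10(b); [Kolyvagin1990] Thm. A; [Gross1991] Thm. 1.3;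
[SilvermanAEC2009] VIII.6.7, X.4.2.
-/

noncomputable section

open scoped Classical

open WeierstrassCurve NumberField IsDedekindDomain Field
open Literature.NumberTheory.EllipticCurves Literature.NumberTheory.EllipticCurves.GreenbergSelmer
  Literature.NumberTheory.EllipticCurves.ModularForms
  Literature.NumberTheory.EllipticCurves.Rank1Residual
  Literature.NumberTheory.EllipticCurves.Rank1Residual.Typed
  Literature.NumberTheory.EllipticCurves.Wuthrich2014
  Literature.NumberTheory.EllipticCurves.BalakrishnanEtAl2019
  Literature.NumberTheory.QuadraticFields.Quadratic
  Literature.NumberTheory.Automorphic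
  Literature.NumberTheory.GaloisRepresentations Literature.NumberTheory.GaloisCohomology
  Summit.BirchSwinnertonDyer.Rank1Residual.X11b.AcSelmer
  Summit.BirchSwinnertonDyer.Rank1Residual.X11b.LocBridge

namespace Summit.BirchSwinnertonDyer.Rank1Residual.X11b

/-! ### Three small pieces: level `0`, `Ш[p^k] ⊆ Ш[p^∞]`, `#Ш[p^∞]` is a power of `p` -/

section Pieces

universe u

variable {K : Type u} [Field K] [NumberField K] (E : WeierstrassCurve K) (p : ℕ) [Fact p.Prime]

omit [Fact p.Prime] in
/-- Level `0` is trivial: `H¹(K, E[1])` is killed by `1`. [folklore] -/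
theorem finite_and_natCard_selmerGroup_acLevelStructure_zero (𝔭 : HeightOneSpectrum (𝓞 K))
    (S : Set (HeightOneSpectrum (𝓞 K))) :
    Finite (acLevelStructure E p 0 𝔭 S).selmerGroup ∧
      Nat.card (acLevelStructure E p 0 𝔭 S).selmerGroup ≤ 1 := by
  have h0 : ∀ x : galoisCohomology (E.torsionGaloisModule ((p ^ 0 : ℕ) : ℤ)) 1, x = 0 := fun x => by
    have h := nsmul_continuousCohomology_one_eq_zero _ 1
      (fun T : geomTorsion E ((p ^ 0 : ℕ) : ℤ) => by simpa using AddSubgroup.torsionBy.nsmul T) x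
    rw [one_smul] at h
    exact h
  haveI : Subsingleton (acLevelStructure E p 0 𝔭 S).selmerGroup :=
    ⟨fun x y => Subtype.ext ((h0 _).trans (h0 _).symm)⟩
  exact ⟨inferInstance, Finite.card_le_one_iff_subsingleton.mpr inferInstance⟩

omit [Fact p.Prime] in
/-- `#(Ш ∩ H¹(K,E)[p^k]) ≤ #Ш[p^∞]` (`Ш` finite). [folklore] -/
theorem natCard_sha_inf_torsionBy_le [Finite E.sha] (k : ℕ) :
    Nat.card ↥(E.sha ⊓ AddSubgroup.torsionBy E.galH1 ((p ^ k : ℕ) : ℤ)) ≤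
      Nat.card (AddCommGroup.primaryComponent E.sha p) := by
  refine Nat.card_le_card_of_injective
    (fun x => (⟨⟨x.1, x.2.1⟩, (AddCommGroup.mem_primaryComponent).mpr ⟨k, Subtype.ext ?_⟩⟩ :
      AddCommGroup.primaryComponent E.sha p)) ?_
  · have hx : (p ^ k) • (x : E.galH1) = 0 := AddSubgroup.torsionBy.nsmul_iff.mp x.2.2
    simpa using hx
  · intro x y hxy
    apply Subtype.ext
    have := congrArg (fun z : AddCommGroup.primaryComponent E.sha p => ((z : E.sha) : E.galH1)) hxy
    exact this

omit [NumberField K] in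
/-- `#Ш[p^∞] = p^v` for some `v` (a finite `p`-primary group). [folklore] -/
theorem exists_natCard_primaryComponent_eq_pow {G : Type*} [AddCommGroup G] [Finite G] :
    ∃ v : ℕ, Nat.card (AddCommGroup.primaryComponent G p) = p ^ v := by
  have hPG : IsPGroup p (Multiplicative (AddCommGroup.primaryComponent G p)) := fun g => by
    obtain ⟨m, hm⟩ := (AddCommGroup.mem_primaryComponent).mp (Multiplicative.toAdd g).2
    refine ⟨m, ?_⟩
    apply Multiplicative.toAdd.injective
    rw [toAdd_pow, toAdd_one]
    exact Subtype.ext (by rw [AddSubmonoidClass.coe_nsmul, hm]; rfl)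
  obtain ⟨v, hv⟩ := IsPGroup.iff_card.mp hPG
  exact ⟨v, hv⟩

end Pieces

/-! ### (d) is a theorem under (iv) -/

/-- **(d) `P2SelmerCardBoundAt W p` FROM PUBLISHED FACTS under (iv).** For a globally minimal elliptic
`W/ℚ` and a prime `p` with `E(ℚ_p)[p] = 0`: at every datum of route p2 (X11b pair, `p ≥ 5`, Heegner
field `K`, Manin-good parametrisation, non-torsion Heegner point `P`, degree-one `𝔭 ∋ p`), Castella's
`Sel_𝔭(K, E[p^∞])` is finite with `#Sel_𝔭(K, E[p^∞]) ≤ p^a`,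
`a ≤ ord_p #Ш(E/K)[p^∞] + 2((ord_p log_ω P − 1) − ord_p[E(K):ℤP]) + ord_p ∏_{w∣p} c_w(E/K)` — the `≤`
half of Cas18 (3.2.1) with (calcul) / JSW17 Prop. 3.2.1 — from Kolyvagin's theorem (`rank E(K) = 1`,
`Ш(E/K)` finite), Poitou–Tate over `K` (Milne I 4.10(b)) and Tate's local Euler characteristic
(Milne I 2.8). CONDITIONAL on these named facts; nothing booked.
[cite: Castella2018, proof of Thm. 2.3, (3.2.1) and (calcul) (arXiv:1704.06608 pp. 5–6)]
[cite: Castella2018Erratum, Thm. 1.1 (iv)] [cite: JetchevSkinnerWan2017, Prop. 3.2.1 and (7.1.5) (arXiv:1512.06894 pp. 10–11, 16)]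
[cite: MilneADT2006, Ch. I, Thm. 4.10(b) and Thm. 2.8] [cite: Kolyvagin1990, Thm. A] [cite: Gross1991, Thm. 1.3] -/
theorem p2SelmerCardBoundAt_of_facts (W : WeierstrassCurve ℚ) [W.IsElliptic] [W.IsGloballyMinimal]
    (p : ℕ) [Fact p.Prime]
    (hiv : ∀ Q : (W.baseChange ℚ_[p]).toAffine.Point, p • Q = 0 → Q = 0)
    (hKo : ∀ (N : ℕ) [NeZero N] (W : WeierstrassCurve ℚ) (K : Type) [Field K] [NumberField K],
      kolyvagin N W K)
    (hPT : ∀ (K : Type) [Field K] [NumberField K], poitouTate_sum_localTatePairing_eq_zero K)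
    (hEP : ∀ (K : Type) [Field K] [NumberField K] (v : HeightOneSpectrum (𝓞 K)),
      localEulerPoincareCharacteristic (v.adicCompletion K)) :
    P2SelmerCardBoundAt W p := by
  intro N _ K _ _ Dt Hg ι
  -- notation (fixed before the point `P` is introduced)
  set E := W.baseChange K with hEdef
  set G := W.baseChange ℚ_[p] with hGdef
  intro P hX hp5 hs hN hK hodd hpd hμ hHN hLt hP hc hPinf κ hκ γ _ 𝔭 h𝔭 he hf
  haveI hEK : E.IsElliptic := by rw [hEdef, baseChange]; infer_instance
  obtain ⟨-, -, hmult, -⟩ := id hX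
  have hpN : p ∣ W.conductorNorm ℤ := dvd_conductorNorm_of_mult hmult
  have hsplit : SplitsIn K p := hHN p Fact.out (hN ▸ hpN)
  have h2 : Module.finrank ℚ K = 2 := hK.1
  have hp : p.Prime := Fact.out
  -- Kolyvagin: `rank E(K) = 1`, `Ш(E/K)` finite
  obtain ⟨hrank, hSha⟩ := hKo N W K hK hHN ⟨Dt, Hg, ι, hP⟩ hPinf
  haveI hShaFin : Finite E.sha := hSha
  set ιp := embAt K p 𝔭 h𝔭 he hf with hιp
  set f : E.toAffine.Point →+ G.toAffine.Point := Affine.Point.map (W' := W) ιp.toRatAlgHom with hfdef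
  have hfapply : ∀ x, f x = padicPointOf W p ιp x := fun _ => rfl
  have hfinj : Function.Injective f := Affine.Point.map_injective (W' := W) ιp.toRatAlgHom
  -- no `p`-torsion in `E(K)` (from (iv) along `f`)
  have hivK : ∀ x : E.toAffine.Point, p • x = 0 → x = 0 := fun x hx => by
    have h1 : f x = 0 := hiv (f x) (by rw [← map_nsmul, hx, map_zero])
    exact hfinj (by rw [h1, map_zero])
  -- a coordinate `c : E(K) → ℤ` and a generator `Q`
  obtain ⟨c, Q, hcQ, hcker⟩ := RankOne.exists_coord_of_mordellWeilRank_eq_one E hrank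
  have hA : ∀ a : E.toAffine.Point, IsOfFinAddOrder (a - c a • Q) :=
    RankOne.isOfFinAddOrder_sub_coord_zsmul c Q hcQ hcker
  have hQinf : ¬ IsOfFinAddOrder Q := fun hQ => by
    have h := RankOne.coord_eq_zero_of_isOfFinAddOrder c hQ
    rw [hcQ] at h
    exact one_ne_zero h
  have hxinf : ¬ IsOfFinAddOrder (padicPointOf W p ιp Q) := fun hx =>
    hQinf ((hfinj.isOfFinAddOrder_iff).mp hx)
  have hyinf : ¬ IsOfFinAddOrder (padicPointOf W p ιp P) := fun hy =>
    hPinf ((hfinj.isOfFinAddOrder_iff).mp hy)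
  have hcP : c P ≠ 0 := fun h0 => hPinf (hcker P h0)
  -- the `p`-adic exponents at `Q` and at `P`
  set cp := padicValNat p (G.localTamagawaNumber ℤ_[p]) with hcpdef
  obtain ⟨eQ, -, heQ⟩ :=
    LocalIndex.index_range_nsmul_sup_zmultiples_padicPointOf_of_mult W p hmult hiv ιp Q hxinf 0
  obtain ⟨eP, -, heP⟩ :=
    LocalIndex.index_range_nsmul_sup_zmultiples_padicPointOf_of_mult W p hmult hiv ιp P hyinf 0
  have heQk : ∀ k, ((nsmulAddMonoidHom (p ^ k) : G.toAffine.Point →+ _).range ⊔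
      AddSubgroup.zmultiples (padicPointOf W p ιp Q)).index = p ^ min k eQ := by
    intro k
    obtain ⟨e', h1, h2⟩ :=
      LocalIndex.index_range_nsmul_sup_zmultiples_padicPointOf_of_mult W p hmult hiv ιp Q hxinf k
    have : e' = eQ := by exact_mod_cast h2.trans heQ.symm
    rw [h1, this]
  have hePk : ∀ k, ((nsmulAddMonoidHom (p ^ k) : G.toAffine.Point →+ _).range ⊔
      AddSubgroup.zmultiples (padicPointOf W p ιp P)).index = p ^ min k eP := by
    intro k
    obtain ⟨e', h1, h2⟩ :=
      LocalIndex.index_range_nsmul_sup_zmultiples_padicPointOf_of_mult W p hmult hiv ιp P hyinf k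
    have : e' = eP := by exact_mod_cast h2.trans heP.symm
    rw [h1, this]
  -- `P_ι = c(P) • Q_ι + f(torsion)`, whence `e_Q + ord_p c(P) ≤ e_P`
  have hyx : padicPointOf W p ιp P = c P • padicPointOf W p ιp Q + f (P - c P • Q) := by
    rw [← hfapply, ← hfapply, map_sub, map_zsmul]; abel
  have hexp : eQ + padicValNat p (c P).natAbs ≤ eP :=
    RankOne.exponent_add_padicValNat_le G hiv hxinf (f.isOfFinAddOrder (hA P)) hyx heQk hePk
  -- `ord_p [E(K) : ℤP] = ord_p |c(P)|`
  haveI : Finite (AddCommGroup.torsion E.toAffine.Point) := E.finite_torsion_point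
  have hI : padicValNat p (AddSubgroup.zmultiples P).index = padicValNat p (c P).natAbs :=
    RankOne.padicValNat_index_zmultiples_eq c Q hcQ hcker hivK P hcP
  -- (v) `ord_p ∏_{w∣p} c_w = 2 ord_p c_p`
  have htam : padicValNat p (tamagawaProductAbove W K p) = 2 * cp :=
    LocalIndexTransport.padicValNat_tamagawaProductAbove_eq_two_mul W K p h2 hsplit
  -- the two primes above `p` and the (iv)-vanishing at `𝔭`
  obtain ⟨σ, 𝔮, hσ, -, -, hall⟩ := LocalIndexTransport.exists_conj_prime_of_splitsIn K p h2 hsplit h𝔭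
  have h𝔮 : ∀ v : HeightOneSpectrum (𝓞 K), v ≠ 𝔭 → ((p : ℕ) : 𝓞 K) ∈ v.asIdeal → v = 𝔮 :=
    fun v hv hpv => (hall v hpv).resolve_left hv
  obtain ⟨eKp⟩ := exists_ringHom_adicCompletion_padic_of_degreeOne p 𝔭 h𝔭 he hf
  have hKv := noPTorsion_baseChange_adicCompletion_of_padic W p 𝔭 eKp hiv
  have hΓ := LocalIndexTransport.eq_zero_of_forall_restrictField_eq E p 𝔭 hKv
  -- `Ш[p^k] ⊆ Ш[p^∞]`, `#Ш[p^∞] = p^v`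
  set S := Nat.card (AddCommGroup.primaryComponent E.sha p) with hSdef
  obtain ⟨v, hv⟩ : ∃ v : ℕ, S = p ^ v := exists_natCard_primaryComponent_eq_pow p
  -- THE LEVEL BOUNDS
  set B : ℕ := p ^ eQ * (S * p ^ eQ) with hBdef
  have hlevel : ∀ k, Finite (acLevelStructure E p k 𝔭 ∅).selmerGroup ∧
      Nat.card (acLevelStructure E p k 𝔭 ∅).selmerGroup ≤ B := by
    intro k
    rcases Nat.eq_zero_or_pos k with rfl | hk
    · obtain ⟨hfin, hle⟩ := finite_and_natCard_selmerGroup_acLevelStructure_zero E p 𝔭 ∅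
      refine ⟨hfin, hle.trans ?_⟩
      have hS1 : 1 ≤ S := by rw [hv]; exact Nat.one_le_pow _ _ hp.pos
      calc 1 ≤ S := hS1
        _ ≤ S * p ^ eQ := Nat.le_mul_of_pos_right _ (pow_pos hp.pos _)
        _ ≤ p ^ eQ * (S * p ^ eQ) := Nat.le_mul_of_pos_left _ (pow_pos hp.pos _)
    · -- the three indices at level `k`
      have hL : ((Affine.Point.baseChange (W' := W.baseChange K) K (𝔭.adicCompletion K)).range ⊔
          (zsmulAddGroupHom ((p ^ k : ℕ) : ℤ) :
            ((W.baseChange K).baseChange (𝔭.adicCompletion K)).toAffine.Point →+ _).range).index =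
          p ^ min k eQ := by
        rw [LocalIndexTransport.index_range_baseChange_sup_eq_padic K p 𝔭 h𝔭 he hf W,
          RankOne.range_zsmulAddGroupHom_natCast, sup_comm]
        change ((nsmulAddMonoidHom (p ^ k) : G.toAffine.Point →+ _).range ⊔ f.range).index = _
        rw [RankOne.range_nsmul_sup_range_eq G f c Q hA k hiv]
        exact heQk k
      have hM : ((zsmulAddGroupHom ((p ^ k : ℕ) : ℤ) :
          ((W.baseChange K).baseChange (𝔭.adicCompletion K)).toAffine.Point →+ _).range).index =
          p ^ k := by
        rw [LocalIndexTransport.index_range_zsmul_eq_padic K p 𝔭 h𝔭 he hf W,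
          RankOne.range_zsmulAddGroupHom_natCast]
        exact RankOne.index_range_nsmul_pow_padic G hiv _ hxinf k
      have hN : ((zsmulAddGroupHom ((p ^ k : ℕ) : ℤ) : E.toAffine.Point →+ _).range).index =
          p ^ k := RankOne.index_range_zsmul_pow_eq c Q hcQ hcker hivK k
      obtain ⟨hfin, hle⟩ := SelmerLevelBound.natCard_level_le_of_indices W K p k 𝔭 𝔮 hk σ hσ
        h𝔮 hΓ (hPT K) (hEP K 𝔮) hL hM (pow_ne_zero _ hp.ne_zero) hN
        (natCard_sha_inf_torsionBy_le E p k)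
      refine ⟨hfin, hle.trans ?_⟩
      have hmin : p ^ min k eQ ≤ p ^ eQ := Nat.pow_le_pow_right hp.pos (min_le_right _ _)
      exact Nat.mul_le_mul hmin (Nat.mul_le_mul_left _ hmin)
  -- pass to the limit
  obtain ⟨hfinSel, hcard⟩ := LevelKummer.exists_finite_selmerAcBase_natCard_le E p 𝔭 ∅
    E.zsmul_geomPoints_surjective_holds B (fun k => (hlevel k).1) (fun k => (hlevel k).2)
  refine ⟨hfinSel, v + 2 * eQ, ?_, ?_⟩
  · calc Nat.card (selmerAcBase E p 𝔭 ∅) ≤ B := hcard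
      _ = p ^ (v + 2 * eQ) := by rw [hBdef, hv]; ring
  · have hvS : padicValNat p S = v := by rw [hv, padicValNat.prime_pow]
    rw [hvS, hI, htam]
    have hexpZ : (eQ : ℤ) + (padicValNat p (c P).natAbs : ℤ) ≤ (eP : ℤ) := by exact_mod_cast hexp
    have hcast : (((v + 2 * eQ : ℕ) : ℤ)) = (v : ℤ) + 2 * (eQ : ℤ) := by push_cast; ring
    have hcast2 : (((2 * cp : ℕ) : ℤ)) = 2 * (cp : ℤ) := by push_cast; ring
    rw [hcast, hcast2]
    linarith [hexpZ, heP]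

/-! ### The statement of record with (d) discharged -/

/-- **THE STATEMENT OF RECORD, (d) DISCHARGED.** `∀ (E, p) ∈` X11b, `p ≥ 5 → BSD(E, p)` from:
FOURTEEN published named facts (Gross–Zagier, Kolyvagin ×2, Skinner 2016 Thm. C, Wuthrich Prop. 21,
GZK, modularity ×2, Hoffstein–Luo, Friedberg–Hoffstein ×2, Mazur 1978, Néron scaling, BDMTV) PLUS
the two TEXTBOOK named facts Poitou–Tate (`poitouTate_sum_localTatePairing_eq_zero`, Milne I
4.10(b)) and Tate's local Euler–Poincaré characteristic (`localEulerPoincareCharacteristic`, Milne I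
2.8); and the typed inputs (T1ᵗ-CTL≤) `P2ControlUpperOnTreeAt` ONLY on the (T2α) sub-shape (split
multiplicative at `p` with `p ∣ ord_p Δ_min` — the only pairs where (iv) can fail); (T1ᵗ-IMC)
`P2OpenInputOnTreeAt` — THE open input at `p ∥ N`; (T2α′); (T2♯-ℝ) `P2ShimuraDisplaysAt`; (T3);
(T4′). The former typed input (d) `P2SelmerCardBoundAt` (Cas18 (3.2.1)+(calcul) `≤`) is now the
THEOREM `p2SelmerCardBoundAt_of_facts`. CONDITIONAL; nothing booked; reach, census numbers and
labels UNCHANGED. [cite: Castella2018, Thm. 2.3, (3.2.1) (arXiv:1704.06608 pp. 5–6), Thm. 3.2 (p. 9)]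
[cite: Castella2018Erratum, Thm. 1.1 (iv), Thm. A′ and Remark] [cite: JetchevSkinnerWan2017, §7.4.1 and Prop. 3.2.1]
[cite: MilneADT2006, Ch. I, Thm. 4.10(b) and Thm. 2.8] [cite: Wuthrich2014, Prop. 21 (p. 400)] [cite: Skinner2016PacificMC, Thm. C] -/
theorem P2.bsdp_of_onTree_selmer
    -- published inputs (named facts of the tree)
    (hGZ : ∀ (N : ℕ) [NeZero N] (W : WeierstrassCurve ℚ) (K : Type) [Field K] [NumberField K],
      gross_zagier N W K)
    (hKo : ∀ (N : ℕ) [NeZero N] (W : WeierstrassCurve ℚ) (K : Type) [Field K] [NumberField K],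
      kolyvagin N W K)
    (hB : ∀ (N : ℕ) [NeZero N] (W : WeierstrassCurve ℚ) (K : Type) [Field K] [NumberField K],
      Kolyvagin1990_padicValNat_card_sha_le N W K)
    (hSk : Skinner2016.thmC_padicValRat_bsd_rank_zero) (hWu : sha_dvd_analyticSha)
    (hGZK : rank_eq_analyticRank_of_analyticRank_le_one) (hmod : hasEntireLFunction_rat)
    (hnf : exists_isNewformOf) (hHL : HoffsteinLuo1997_exists_twist_L_one_ne_zero)
    (hFHs : friedbergHoffstein_exists_heegnerField_split_twist_ne_zero)
    (hMaz : mazur_not_dvd_maninConstant_of_odd) (hNS : integral_neronScaling_of_isGloballyMinimal)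
    (hBDMTV : thm12_not_le_normalizer_splitCartan)
    (hFH : friedbergHoffstein_exists_twist_ne_zero_inertAt)
    -- the two textbook facts (Milne ADT I 4.10(b), I 2.8)
    (hPT : ∀ (K : Type) [Field K] [NumberField K], poitouTate_sum_localTatePairing_eq_zero K)
    (hEP : ∀ (K : Type) [Field K] [NumberField K] (v : HeightOneSpectrum (𝓞 K)),
      localEulerPoincareCharacteristic (v.adicCompletion K))
    -- (T1ᵗ-CTL≤) PUB shape, ONLY on the (T2α) sub-shape (split at `p`, `p ∣ ord_p Δ_min`)
    (hC₀ : ∀ (W : WeierstrassCurve ℚ) [W.IsElliptic] [W.IsGloballyMinimal] (p : ℕ) [Fact p.Prime],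
      W.HasSplitMultiplicativeReductionAtPrime p → p ∣ padicValInt p W.minimalDiscriminantInt →
        P2ControlUpperOnTreeAt W p)
    -- (T1ᵗ-IMC) THE open input
    (hA : ∀ (W : WeierstrassCurve ℚ) [W.IsElliptic] [W.IsGloballyMinimal] (p : ℕ) [Fact p.Prime],
      P2OpenInputOnTreeAt W p)
    -- (T2α′)
    (hUα : ∀ (W : WeierstrassCurve ℚ) [W.IsElliptic] [W.IsGloballyMinimal] (p : ℕ) [Fact p.Prime],
      ClassX11b W p → 5 ≤ p → p ∣ W.tamagawaProduct →
      (¬ Ram W p ∨ (W.HasSplitMultiplicativeReductionAtPrime p ∧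
        p ∣ padicValInt p W.minimalDiscriminantInt)) → Typed.MissingUpperBoundAt W p)
    -- (T2♯-ℝ) the Shimura displays, weakest form
    (hSh : ∀ (W : WeierstrassCurve ℚ) [W.IsElliptic] [W.IsGloballyMinimal] (p : ℕ) [Fact p.Prime],
      ClassX11b W p → 5 ≤ p → P2ShimuraDisplaysAt W p)
    -- (T3)
    (hX11a : ∀ (Wd : WeierstrassCurve ℚ) [Wd.IsElliptic] [Wd.IsGloballyMinimal] (p : ℕ)
      [Fact p.Prime], ClassX11a Wd p → Typed.MissingLowerBoundAt Wd p)
    -- (T4′)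
    (hCorner : ∀ (W : WeierstrassCurve ℚ) [W.IsElliptic] [W.IsGloballyMinimal] (p : ℕ)
      [Fact p.Prime], ClassX11b W p → ¬ Surj W p → (p = 5 ∨ p = 7) →
        p ∣ padicValInt p W.minimalDiscriminantInt → ¬ Ram W p → Typed.MissingPPartAt W p)
    (W : WeierstrassCurve ℚ) [W.IsElliptic] [W.IsGloballyMinimal] (p : ℕ) [Fact p.Prime]
    (hX : ClassX11b W p) (hp5 : 5 ≤ p) : BSDp W p :=
  P2.bsdp_of_onTree_weakest_alpha hGZ hKo hB hSk hWu hGZK hmod hnf hHL hFHs hMaz hNS hBDMTV hFH hC₀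
    (fun W _ _ p _ hiv => p2SelmerCardBoundAt_of_facts W p hiv hKo hPT hEP) hA hUα hSh hX11a hCorner
    W p hX hp5

/-- **THE STATEMENT OF RECORD, SHARPEST FORM: the control input demanded ONLY WHERE (iv) FAILS.**
`P2.bsdp_of_onTree_weakest_split` with its (d)-branch `hC₁` supplied by the theorem
`p2SelmerCardBoundAt_of_facts`: `∀ (E, p) ∈` X11b, `p ≥ 5 → BSD(E, p)` from SIXTEEN published named
facts (the fourteen + Poitou–Tate + the local Euler characteristic) and the typed inputs
(T1ᵗ-CTL≤) `P2ControlUpperOnTreeAt` [PUB shape, Cas18 Thm. 2.3 `≤`] ONLY at the pairs where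
`E(ℚ_p)[p] ≠ 0` (a decidable local condition: split multiplicative at `p` with the Tate period a
`p`-th power in `ℚ_pˣ` — inside the (T2α) sub-shape, cf. `localTorsion_eq_zero_of_classX11b`);
(T1ᵗ-IMC) `P2OpenInputOnTreeAt` — THE open input at `p ∥ N`; (T2α′); (T2♯-ℝ) `P2ShimuraDisplaysAt`;
(T3); (T4′). Implies `P2.bsdp_of_onTree_selmer` (whose control input covers all of (T2α)).
CONDITIONAL; nothing booked; reach, census numbers and labels UNCHANGED.
[cite: Castella2018, Thm. 2.3, (3.2.1) (arXiv:1704.06608 pp. 5–6), Thm. 3.2 (p. 9)]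
[cite: Castella2018Erratum, Thm. 1.1 (iv)] [cite: JetchevSkinnerWan2017, §7.4.1 and Prop. 3.2.1]
[cite: MilneADT2006, Ch. I, Thm. 4.10(b) and Thm. 2.8] [cite: Wuthrich2014, Prop. 21 (p. 400)] [cite: Skinner2016PacificMC, Thm. C] -/
theorem P2.bsdp_of_onTree_selmer_split
    -- published inputs (named facts of the tree)
    (hGZ : ∀ (N : ℕ) [NeZero N] (W : WeierstrassCurve ℚ) (K : Type) [Field K] [NumberField K],
      gross_zagier N W K)
    (hKo : ∀ (N : ℕ) [NeZero N] (W : WeierstrassCurve ℚ) (K : Type) [Field K] [NumberField K],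
      kolyvagin N W K)
    (hB : ∀ (N : ℕ) [NeZero N] (W : WeierstrassCurve ℚ) (K : Type) [Field K] [NumberField K],
      Kolyvagin1990_padicValNat_card_sha_le N W K)
    (hSk : Skinner2016.thmC_padicValRat_bsd_rank_zero) (hWu : sha_dvd_analyticSha)
    (hGZK : rank_eq_analyticRank_of_analyticRank_le_one) (hmod : hasEntireLFunction_rat)
    (hnf : exists_isNewformOf) (hHL : HoffsteinLuo1997_exists_twist_L_one_ne_zero)
    (hFHs : friedbergHoffstein_exists_heegnerField_split_twist_ne_zero)
    (hMaz : mazur_not_dvd_maninConstant_of_odd) (hNS : integral_neronScaling_of_isGloballyMinimal)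
    (hBDMTV : thm12_not_le_normalizer_splitCartan)
    (hFH : friedbergHoffstein_exists_twist_ne_zero_inertAt)
    -- the two textbook facts (Milne ADT I 4.10(b), I 2.8)
    (hPT : ∀ (K : Type) [Field K] [NumberField K], poitouTate_sum_localTatePairing_eq_zero K)
    (hEP : ∀ (K : Type) [Field K] [NumberField K] (v : HeightOneSpectrum (𝓞 K)),
      localEulerPoincareCharacteristic (v.adicCompletion K))
    -- (T1ᵗ-CTL≤) PUB shape, ONLY where (iv) fails
    (hC₀ : ∀ (W : WeierstrassCurve ℚ) [W.IsElliptic] [W.IsGloballyMinimal] (p : ℕ) [Fact p.Prime],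
      ¬ (∀ Q : (W.baseChange ℚ_[p]).toAffine.Point, p • Q = 0 → Q = 0) → P2ControlUpperOnTreeAt W p)
    -- (T1ᵗ-IMC) THE open input
    (hA : ∀ (W : WeierstrassCurve ℚ) [W.IsElliptic] [W.IsGloballyMinimal] (p : ℕ) [Fact p.Prime],
      P2OpenInputOnTreeAt W p)
    -- (T2α′)
    (hUα : ∀ (W : WeierstrassCurve ℚ) [W.IsElliptic] [W.IsGloballyMinimal] (p : ℕ) [Fact p.Prime],
      ClassX11b W p → 5 ≤ p → p ∣ W.tamagawaProduct →
      (¬ Ram W p ∨ (W.HasSplitMultiplicativeReductionAtPrime p ∧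
        p ∣ padicValInt p W.minimalDiscriminantInt)) → Typed.MissingUpperBoundAt W p)
    -- (T2♯-ℝ) the Shimura displays, weakest form
    (hSh : ∀ (W : WeierstrassCurve ℚ) [W.IsElliptic] [W.IsGloballyMinimal] (p : ℕ) [Fact p.Prime],
      ClassX11b W p → 5 ≤ p → P2ShimuraDisplaysAt W p)
    -- (T3)
    (hX11a : ∀ (Wd : WeierstrassCurve ℚ) [Wd.IsElliptic] [Wd.IsGloballyMinimal] (p : ℕ)
      [Fact p.Prime], ClassX11a Wd p → Typed.MissingLowerBoundAt Wd p)
    -- (T4′)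
    (hCorner : ∀ (W : WeierstrassCurve ℚ) [W.IsElliptic] [W.IsGloballyMinimal] (p : ℕ)
      [Fact p.Prime], ClassX11b W p → ¬ Surj W p → (p = 5 ∨ p = 7) →
        p ∣ padicValInt p W.minimalDiscriminantInt → ¬ Ram W p → Typed.MissingPPartAt W p)
    (W : WeierstrassCurve ℚ) [W.IsElliptic] [W.IsGloballyMinimal] (p : ℕ) [Fact p.Prime]
    (hX : ClassX11b W p) (hp5 : 5 ≤ p) : BSDp W p :=
  P2.bsdp_of_onTree_weakest_split hGZ hKo hB hSk hWu hGZK hmod hnf hHL hFHs hMaz hNS hBDMTV hFH hC₀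
    (fun W _ _ p _ hiv => p2SelmerCardBoundAt_of_facts W p hiv hKo hPT hEP) hA hUα hSh hX11a hCorner
    W p hX hp5

end Summit.BirchSwinnertonDyer.Rank1Residual.X11b

end
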